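import Summits.BirchSwinnertonDyer.BirchSwinnertonDyer.Theorems.PrintX9MuPartStubH5bAtSOfClauseZero
import HarnessLib

/-!
# `Stmt.h5bAtS` with the `he_red` binder (D1 assembly v3 letter) from the `k = 0` clause above `p` (adapter)

Summits-side helper for the line `spec_witnesses` on the shared deciding μ-crux μP-CG `MuInequalityCoherentPairOfPrintCG`
(stmt-BirchSwinnertonDyer-23428; skeleton v7 of μ-LEAD `bsd-line-x9-p1` g4, registered stub `stub_h5bAtS : Stmt.h5bAtS`);
cell `pub/bsd-print-x9`, seat `bsd-line-x10b-p1-w8` g3.  `--supports` stmt-BirchSwinnertonDyer-23428.  THEOREMS ONLY.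

LEAD `bsd-line-x10b-p1` g8 (D1 custodian), RESHAPE REQUEST 22:01:56Z: the D1 assembly v3 inserts into `Stmt.h4AtS` AND
`Stmt.h5bAtS` one binder right after the clause `(D k).e = eisensteinDualityForm …` — the reduction compatibility `he_red` of
the H.4 data (`reduce ((D (k+1)).e x y) = (D k).e (red x) (red y)`), which the H.4 bricks consume and which is exported by
`HeegnerMuPartHowardSettingERed.exists_eisensteinSettingData_satisfiesH_eRed_of_thm413Hypotheses` (p670309).  No H.5(b) brick
uses `he_red`, so for `Stmt.h5bAtS` the v3 letter is the v2 letter (skeleton v6/v7, D1 file of 19:09Z — the one x10b-p1-w8 g3's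
`h5bAtS_of_clauseZeroP` (p670626) concludes) WEAKENED by one ignored hypothesis:
* `h5bAtSERed_of_h5bAtS` — `Stmt.h5bAtS` (v2/v7 letter) ⟹ `Stmt.h5bAtS` (v3 letter, with `he_red`);
* **`h5bAtSERed_of_clauseZeroP`** — `Stmt.h5bAtSZeroP → Stmt.h5bAtS` (v3 letter) = `h5bAtSERed_of_h5bAtS ∘ h5bAtS_of_clauseZeroP`.
So whichever of the two letters skeleton v8 registers for `stub_h5bAtS`, the `k = 0` clause above `p` closes it BY NAME.
HONEST FRAMING: the `v ∣ p` clause is NOT proved here; no summit statement is proved; the μ-crux is not asserted; BSD is not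
proved by any of this.

References: [Howard2004HeegnerKolyvagin] §1.3 H.4, H.5(b) (arXiv:1202.6340 p. 7 L69–97), §1.6 (p. 11 L33–38); [CastellaGrossiLeeSkinner2022] §3.2.
-/

set_option linter.dupNamespace false
set_option autoImplicit false

noncomputable section

open scoped Classical Pointwise ContRepresentation TensorProduct NumberField

open Function NumberField IsDedekindDomain Field
open Literature Literature.NumberTheory.EllipticCurves WeierstrassCurve
open Literature.NumberTheory.GaloisCohomology Literature.NumberTheory.GaloisCohomology.Howard2004
open Literature.NumberTheory.GaloisRepresentations Literature.NumberTheory.GaloisRepresentations.DiscreteGaloisModule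
open Literature.NumberTheory.Automorphic
open Literature.NumberTheory.EllipticCurves.ZpExtension (EisensteinLevel)
open Summit.BirchSwinnertonDyer.BirchSwinnertonDyer.Theorems

namespace Summit.BirchSwinnertonDyer.BirchSwinnertonDyer.Theorems.HeegnerMuPartH5bAtS

set_option synthInstance.maxHeartbeats 80000 in
/-- **`Stmt.h5bAtS` with `he_red` from `Stmt.h5bAtS` without it** (the v3 letter of D1's assembly is the v2/v7 letter weakened
by the ignored hypothesis `he_red`). [cite: Howard2004HeegnerKolyvagin, §1.3 H.4 and H.5(b) (arXiv:1202.6340 p. 7 L69–97)] -/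
theorem h5bAtSERed_of_h5bAtS
    (H5 :
    ∀ (N : ℕ) [NeZero N] (W : WeierstrassCurve ℚ) [W.IsGloballyMinimal] (K : Type) [Field K] [NumberField K]
      (p : ℕ) [Fact p.Prime] (κ : ZpExtension K p) (γ : Field.absoluteGaloisGroup K)
      (hyp : CastellaGrossiLeeSkinner2022.Thm413Hypotheses N W K p κ γ),
      W.HasIrreducibleModPGaloisRep p → (W.baseChange K).HasIrreducibleModPGaloisRep p →
      haveI := hyp.isElliptic
      ∀ (S : Finset (HeightOneSpectrum (𝓞 K)))
        (hpS : ∀ v, ((p : ℕ) : 𝓞 K) ∈ v.asIdeal → v ∈ S)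
        (hbad : ∀ v, v ∉ S → ((p : ℕ) : 𝓞 K) ∉ v.asIdeal → (W.baseChange K).HasGoodReductionAt v),
      (∀ v ∈ S, ((p : ℕ) : 𝓞 K) ∈ v.asIdeal ∨ ((N : ℕ) : 𝓞 K) ∈ v.asIdeal) →
      (∀ (σ : K ≃ₐ[ℚ] K) (v : HeightOneSpectrum (𝓞 K)), σ • v ∈ S → v ∈ S) →
      ∃ m₅ : ℕ, ∀ (m : ℕ) (hm : 1 ≤ m), m₅ ≤ m →
        letI := IwasawaAlgebra.isDomain_quotient_X_pow_add_C p hm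
        letI := IwasawaAlgebra.isDiscreteValuationRing_quotient_X_pow_add_C p hm
        haveI := IwasawaAlgebra.EisensteinCoeff.isLocalRing_succ p hm
        letI := IwasawaAlgebra.EisensteinCoeff.algebraOfSpecSucc p m
        haveI := W.isScalarTower_algebraOfSpecSucc (K := K) (p := p) (m := m)
        letI := W.residueModuleSucc (K := K) (p := p) hm
        ∀ (π : ∀ v : HeightOneSpectrum (𝓞 K), TamePin v) (L : Set (HeightOneSpectrum (𝓞 K)))
          (hL : L ⊆ (W.eisensteinTower (κ.unitTwist (-1)) hm).degreeTwoPrimes p) (hLS : ∀ v ∈ L, v ∉ S)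
          (jbar' : AlgebraicClosure K →+* ℂ)
          (c₀ : absoluteGaloisGroup ℚ) (σ : K ≃ₐ[ℚ] K) (hσ₁ : σ ≠ 1) (hσ : σ * σ = 1)
          (hτl : IsLiftOfAut σ (absGaloisTransport (K := ℚ) (L := K) c₀).toRingEquiv)
          (hτ₂ : Function.Involutive (absGaloisTransport (K := ℚ) (L := K) c₀).toRingEquiv)
          (D : ∀ k, DualityDatum p (ConjugationDatum.ofLifts σ hσ₁ hσ _ hτl hτ₂)
            ((W.eisensteinTower (κ.unitTwist (-1)) hm).ρ k) (IwasawaAlgebra.EisensteinCoeff p m (k + 1)))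
          (e : ∀ j : ℕ, geomTorsion (W.baseChange K) ((p : ℤ) ^ j) →+ geomTorsion (W.baseChange K) ((p : ℤ) ^ j) →+
            MuCarrier K (p ^ j))
          (log : ∀ j : ℕ, MuCarrier K (p ^ j) →+ ZMod (p ^ j)),
          IsComplexConjugation (Rat.castHom ℝ) c₀ →
          (∀ x, (ConjugationDatum.ofLifts σ hσ₁ hσ _ hτl hτ₂).τ x = absGaloisTransport (K := ℚ) (L := K) c₀ x) →
          (∀ k, (D k).e = ZpExtension.eisensteinDualityForm hm (k + 1)
            (conjPairing (e (k + 1)) ((ConjugationDatum.ofLifts σ hσ₁ hσ _ hτl hτ₂).isLift.torsionMap W _)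
              (log (k + 1)))) →
          (∀ j a, e j a a = 0) →
          (∀ j (g : absoluteGaloisGroup K) a b, e j (g • a) (g • b) = mu K (p ^ j) g (e j a b)) →
          (∀ j a b, e j ((ConjugationDatum.ofLifts σ hσ₁ hσ _ hτl hτ₂).isLift.torsionMap W _ a)
            ((ConjugationDatum.ofLifts σ hσ₁ hσ _ hτl hτ₂).isLift.torsionMap W _ b) = -e j a b) →
          (∀ j (a : geomTorsion (W.baseChange K) ((p : ℤ) ^ j)),
            (ConjugationDatum.ofLifts σ hσ₁ hσ _ hτl hτ₂).isLift.torsionMap W _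
              ((ConjugationDatum.ofLifts σ hσ₁ hσ _ hτl hτ₂).isLift.torsionMap W _ a) = a) →
          (∀ j, Function.Bijective (log j)) →
          (∀ j (g : absoluteGaloisGroup K) ξ, log j (mu K (p ^ j) g ξ) = cyclotomicCharacterModPow K p j g * log j ξ) →
          ∀ k, ∀ v ∈ S,
            (((W.isQuotientBy_eisensteinDVRSetting_πbar (κ.unitTwist (-1)) hm S hpS hbad L hL hLS jbar'
                (ConjugationDatum.ofLifts σ hσ₁ hσ _ hτl hτ₂) D
                (W.eisensteinLevelsTameFs (κ.unitTwist (-1)) hm π S hpS hbad L hL hLS)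
                k).propagateStructure (W.eisensteinTowerTriple (κ.unitTwist (-1)) hm S hpS hbad L hL hLS k).cond)
                (Sum.inr (σ • v))).map
                (((W.residualTauGeomTorsion (p := p) (ConjugationDatum.ofLifts σ hσ₁ hσ _ hτl hτ₂) hm (k := k + 1)
                    k.succ_pos).thetaH1 (Sum.inr v)).comp
                  ((ConjugationDatum.ofLifts σ hσ₁ hσ _ hτl hτ₂).transportH1
                    ((W.baseChange K).torsionGaloisModule (p : ℤ)) v)) =
              ((W.isQuotientBy_eisensteinDVRSetting_πbar (κ.unitTwist (-1)) hm S hpS hbad L hL hLS jbar'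
                (ConjugationDatum.ofLifts σ hσ₁ hσ _ hτl hτ₂) D
                (W.eisensteinLevelsTameFs (κ.unitTwist (-1)) hm π S hpS hbad L hL hLS)
                k).propagateStructure (W.eisensteinTowerTriple (κ.unitTwist (-1)) hm S hpS hbad L hL hLS k).cond)
                (Sum.inr v)) :
    ∀ (N : ℕ) [NeZero N] (W : WeierstrassCurve ℚ) [W.IsGloballyMinimal] (K : Type) [Field K] [NumberField K]
      (p : ℕ) [Fact p.Prime] (κ : ZpExtension K p) (γ : Field.absoluteGaloisGroup K)
      (hyp : CastellaGrossiLeeSkinner2022.Thm413Hypotheses N W K p κ γ),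
      W.HasIrreducibleModPGaloisRep p → (W.baseChange K).HasIrreducibleModPGaloisRep p →
      haveI := hyp.isElliptic
      ∀ (S : Finset (HeightOneSpectrum (𝓞 K)))
        (hpS : ∀ v, ((p : ℕ) : 𝓞 K) ∈ v.asIdeal → v ∈ S)
        (hbad : ∀ v, v ∉ S → ((p : ℕ) : 𝓞 K) ∉ v.asIdeal → (W.baseChange K).HasGoodReductionAt v),
      (∀ v ∈ S, ((p : ℕ) : 𝓞 K) ∈ v.asIdeal ∨ ((N : ℕ) : 𝓞 K) ∈ v.asIdeal) →
      (∀ (σ : K ≃ₐ[ℚ] K) (v : HeightOneSpectrum (𝓞 K)), σ • v ∈ S → v ∈ S) →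
      ∃ m₅ : ℕ, ∀ (m : ℕ) (hm : 1 ≤ m), m₅ ≤ m →
        letI := IwasawaAlgebra.isDomain_quotient_X_pow_add_C p hm
        letI := IwasawaAlgebra.isDiscreteValuationRing_quotient_X_pow_add_C p hm
        haveI := IwasawaAlgebra.EisensteinCoeff.isLocalRing_succ p hm
        letI := IwasawaAlgebra.EisensteinCoeff.algebraOfSpecSucc p m
        haveI := W.isScalarTower_algebraOfSpecSucc (K := K) (p := p) (m := m)
        letI := W.residueModuleSucc (K := K) (p := p) hm
        ∀ (π : ∀ v : HeightOneSpectrum (𝓞 K), TamePin v) (L : Set (HeightOneSpectrum (𝓞 K)))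
          (hL : L ⊆ (W.eisensteinTower (κ.unitTwist (-1)) hm).degreeTwoPrimes p) (hLS : ∀ v ∈ L, v ∉ S)
          (jbar' : AlgebraicClosure K →+* ℂ)
          (c₀ : absoluteGaloisGroup ℚ) (σ : K ≃ₐ[ℚ] K) (hσ₁ : σ ≠ 1) (hσ : σ * σ = 1)
          (hτl : IsLiftOfAut σ (absGaloisTransport (K := ℚ) (L := K) c₀).toRingEquiv)
          (hτ₂ : Function.Involutive (absGaloisTransport (K := ℚ) (L := K) c₀).toRingEquiv)
          (D : ∀ k, DualityDatum p (ConjugationDatum.ofLifts σ hσ₁ hσ _ hτl hτ₂)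
            ((W.eisensteinTower (κ.unitTwist (-1)) hm).ρ k) (IwasawaAlgebra.EisensteinCoeff p m (k + 1)))
          (e : ∀ j : ℕ, geomTorsion (W.baseChange K) ((p : ℤ) ^ j) →+ geomTorsion (W.baseChange K) ((p : ℤ) ^ j) →+
            MuCarrier K (p ^ j))
          (log : ∀ j : ℕ, MuCarrier K (p ^ j) →+ ZMod (p ^ j)),
          IsComplexConjugation (Rat.castHom ℝ) c₀ →
          (∀ x, (ConjugationDatum.ofLifts σ hσ₁ hσ _ hτl hτ₂).τ x = absGaloisTransport (K := ℚ) (L := K) c₀ x) →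
          (∀ k, (D k).e = ZpExtension.eisensteinDualityForm hm (k + 1)
            (conjPairing (e (k + 1)) ((ConjugationDatum.ofLifts σ hσ₁ hσ _ hτl hτ₂).isLift.torsionMap W _)
              (log (k + 1)))) →
          (∀ k (x y : EisensteinLevel p m (fun j ↦ geomTorsion (W.baseChange K) ((p : ℤ) ^ j)) (k + 1 + 1)),
            IwasawaAlgebra.EisensteinCoeff.reduce p m (Nat.le_succ (k + 1)) ((D (k + 1)).e x y) =
              (D k).e ((W.eisensteinTower (κ.unitTwist (-1)) hm).red k x) ((W.eisensteinTower (κ.unitTwist (-1)) hm).red k y)) →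
          (∀ j a, e j a a = 0) →
          (∀ j (g : absoluteGaloisGroup K) a b, e j (g • a) (g • b) = mu K (p ^ j) g (e j a b)) →
          (∀ j a b, e j ((ConjugationDatum.ofLifts σ hσ₁ hσ _ hτl hτ₂).isLift.torsionMap W _ a)
            ((ConjugationDatum.ofLifts σ hσ₁ hσ _ hτl hτ₂).isLift.torsionMap W _ b) = -e j a b) →
          (∀ j (a : geomTorsion (W.baseChange K) ((p : ℤ) ^ j)),
            (ConjugationDatum.ofLifts σ hσ₁ hσ _ hτl hτ₂).isLift.torsionMap W _
              ((ConjugationDatum.ofLifts σ hσ₁ hσ _ hτl hτ₂).isLift.torsionMap W _ a) = a) →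
          (∀ j, Function.Bijective (log j)) →
          (∀ j (g : absoluteGaloisGroup K) ξ, log j (mu K (p ^ j) g ξ) = cyclotomicCharacterModPow K p j g * log j ξ) →
          ∀ k, ∀ v ∈ S,
            (((W.isQuotientBy_eisensteinDVRSetting_πbar (κ.unitTwist (-1)) hm S hpS hbad L hL hLS jbar'
                (ConjugationDatum.ofLifts σ hσ₁ hσ _ hτl hτ₂) D
                (W.eisensteinLevelsTameFs (κ.unitTwist (-1)) hm π S hpS hbad L hL hLS)
                k).propagateStructure (W.eisensteinTowerTriple (κ.unitTwist (-1)) hm S hpS hbad L hL hLS k).cond)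
                (Sum.inr (σ • v))).map
                (((W.residualTauGeomTorsion (p := p) (ConjugationDatum.ofLifts σ hσ₁ hσ _ hτl hτ₂) hm (k := k + 1)
                    k.succ_pos).thetaH1 (Sum.inr v)).comp
                  ((ConjugationDatum.ofLifts σ hσ₁ hσ _ hτl hτ₂).transportH1
                    ((W.baseChange K).torsionGaloisModule (p : ℤ)) v)) =
              ((W.isQuotientBy_eisensteinDVRSetting_πbar (κ.unitTwist (-1)) hm S hpS hbad L hL hLS jbar'
                (ConjugationDatum.ofLifts σ hσ₁ hσ _ hτl hτ₂) D
                (W.eisensteinLevelsTameFs (κ.unitTwist (-1)) hm π S hpS hbad L hL hLS)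
                k).propagateStructure (W.eisensteinTowerTriple (κ.unitTwist (-1)) hm S hpS hbad L hL hLS k).cond)
                (Sum.inr v) := by
  intro N _ W _ K _ _ p _ κ γ hyp hirr hirrK S hpS hbad hSN hSσ
  obtain ⟨m₅, hH5⟩ := H5 N W K p κ γ hyp hirr hirrK S hpS hbad hSN hSσ
  refine ⟨m₅, fun m hm hle ↦ ?_⟩
  intro π L hL hLS jbar' c₀ σ hσ₁ hσ hτl hτ₂ D e log hc₀ hτ hDe _he_red h4' h5' h6' h7' h8' h9'
  exact hH5 m hm hle π L hL hLS jbar' c₀ σ hσ₁ hσ hτl hτ₂ D e log hc₀ hτ hDe h4' h5' h6' h7' h8' h9'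

set_option synthInstance.maxHeartbeats 80000 in
/-- **`Stmt.h5bAtS` in D1's v3 letter (with `he_red`) from the level-`0` clause above `p`** (`Stmt.h5bAtSZeroP`, the hypothesis
of `h5bAtS_of_clauseZeroP`, p670626): `h5bAtSERed_of_h5bAtS ∘ h5bAtS_of_clauseZeroP`.
[cite: Howard2004HeegnerKolyvagin, §1.3 H.5(b) (arXiv:1202.6340 p. 7 L96–97), §1.6 (p. 12 L29–55), §2.2, Def. 3.1.2]
[cite: CastellaGrossiLeeSkinner2022, §3.2 and §3.4] -/
theorem h5bAtSERed_of_clauseZeroP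
    (H5P :
    ∀ (N : ℕ) [NeZero N] (W : WeierstrassCurve ℚ) [W.IsGloballyMinimal] (K : Type) [Field K] [NumberField K]
      (p : ℕ) [Fact p.Prime] (κ : ZpExtension K p) (γ : Field.absoluteGaloisGroup K)
      (hyp : CastellaGrossiLeeSkinner2022.Thm413Hypotheses N W K p κ γ),
      W.HasIrreducibleModPGaloisRep p → (W.baseChange K).HasIrreducibleModPGaloisRep p →
      haveI := hyp.isElliptic
      ∀ (S : Finset (HeightOneSpectrum (𝓞 K)))
        (hpS : ∀ v, ((p : ℕ) : 𝓞 K) ∈ v.asIdeal → v ∈ S)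
        (hbad : ∀ v, v ∉ S → ((p : ℕ) : 𝓞 K) ∉ v.asIdeal → (W.baseChange K).HasGoodReductionAt v),
      (∀ v ∈ S, ((p : ℕ) : 𝓞 K) ∈ v.asIdeal ∨ ((N : ℕ) : 𝓞 K) ∈ v.asIdeal) →
      (∀ (σ : K ≃ₐ[ℚ] K) (v : HeightOneSpectrum (𝓞 K)), σ • v ∈ S → v ∈ S) →
      ∀ v ∈ S, ((p : ℕ) : 𝓞 K) ∈ v.asIdeal →
      ∃ m₁ : ℕ, ∀ (m : ℕ) (hm : 1 ≤ m), m₁ < m →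
        letI := IwasawaAlgebra.isDomain_quotient_X_pow_add_C p hm
        letI := IwasawaAlgebra.isDiscreteValuationRing_quotient_X_pow_add_C p hm
        haveI := IwasawaAlgebra.EisensteinCoeff.isLocalRing_succ p hm
        letI := IwasawaAlgebra.EisensteinCoeff.algebraOfSpecSucc p m
        haveI := W.isScalarTower_algebraOfSpecSucc (K := K) (p := p) (m := m)
        letI := W.residueModuleSucc (K := K) (p := p) hm
        ∀ (π : ∀ v : HeightOneSpectrum (𝓞 K), TamePin v) (L : Set (HeightOneSpectrum (𝓞 K)))
          (hL : L ⊆ (W.eisensteinTower (κ.unitTwist (-1)) hm).degreeTwoPrimes p) (hLS : ∀ v ∈ L, v ∉ S)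
          (jbar' : AlgebraicClosure K →+* ℂ)
          (c₀ : absoluteGaloisGroup ℚ) (σ : K ≃ₐ[ℚ] K) (hσ₁ : σ ≠ 1) (hσ : σ * σ = 1)
          (hτl : IsLiftOfAut σ (absGaloisTransport (K := ℚ) (L := K) c₀).toRingEquiv)
          (hτ₂ : Function.Involutive (absGaloisTransport (K := ℚ) (L := K) c₀).toRingEquiv)
          (D : ∀ k, DualityDatum p (ConjugationDatum.ofLifts σ hσ₁ hσ _ hτl hτ₂)
            ((W.eisensteinTower (κ.unitTwist (-1)) hm).ρ k) (IwasawaAlgebra.EisensteinCoeff p m (k + 1)))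
          (e : ∀ j : ℕ, geomTorsion (W.baseChange K) ((p : ℤ) ^ j) →+ geomTorsion (W.baseChange K) ((p : ℤ) ^ j) →+
            MuCarrier K (p ^ j))
          (log : ∀ j : ℕ, MuCarrier K (p ^ j) →+ ZMod (p ^ j)),
          IsComplexConjugation (Rat.castHom ℝ) c₀ →
          (∀ x, (ConjugationDatum.ofLifts σ hσ₁ hσ _ hτl hτ₂).τ x = absGaloisTransport (K := ℚ) (L := K) c₀ x) →
          (∀ k, (D k).e = ZpExtension.eisensteinDualityForm hm (k + 1)
            (conjPairing (e (k + 1)) ((ConjugationDatum.ofLifts σ hσ₁ hσ _ hτl hτ₂).isLift.torsionMap W _)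
              (log (k + 1)))) →
          (∀ j a, e j a a = 0) →
          (∀ j (g : absoluteGaloisGroup K) a b, e j (g • a) (g • b) = mu K (p ^ j) g (e j a b)) →
          (∀ j a b, e j ((ConjugationDatum.ofLifts σ hσ₁ hσ _ hτl hτ₂).isLift.torsionMap W _ a)
            ((ConjugationDatum.ofLifts σ hσ₁ hσ _ hτl hτ₂).isLift.torsionMap W _ b) = -e j a b) →
          (∀ j (a : geomTorsion (W.baseChange K) ((p : ℤ) ^ j)),
            (ConjugationDatum.ofLifts σ hσ₁ hσ _ hτl hτ₂).isLift.torsionMap W _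
              ((ConjugationDatum.ofLifts σ hσ₁ hσ _ hτl hτ₂).isLift.torsionMap W _ a) = a) →
          (∀ j, Function.Bijective (log j)) →
          (∀ j (g : absoluteGaloisGroup K) ξ, log j (mu K (p ^ j) g ξ) = cyclotomicCharacterModPow K p j g * log j ξ) →
            (((W.isQuotientBy_eisensteinDVRSetting_πbar (κ.unitTwist (-1)) hm S hpS hbad L hL hLS jbar'
                (ConjugationDatum.ofLifts σ hσ₁ hσ _ hτl hτ₂) D
                (W.eisensteinLevelsTameFs (κ.unitTwist (-1)) hm π S hpS hbad L hL hLS)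
                0).propagateStructure (W.eisensteinTowerTriple (κ.unitTwist (-1)) hm S hpS hbad L hL hLS 0).cond)
                (Sum.inr (σ • v))).map
                (((W.residualTauGeomTorsion (p := p) (ConjugationDatum.ofLifts σ hσ₁ hσ _ hτl hτ₂) hm (k := 0 + 1)
                    (Nat.succ_pos 0)).thetaH1 (Sum.inr v)).comp
                  ((ConjugationDatum.ofLifts σ hσ₁ hσ _ hτl hτ₂).transportH1
                    ((W.baseChange K).torsionGaloisModule (p : ℤ)) v)) =
              ((W.isQuotientBy_eisensteinDVRSetting_πbar (κ.unitTwist (-1)) hm S hpS hbad L hL hLS jbar'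
                (ConjugationDatum.ofLifts σ hσ₁ hσ _ hτl hτ₂) D
                (W.eisensteinLevelsTameFs (κ.unitTwist (-1)) hm π S hpS hbad L hL hLS)
                0).propagateStructure (W.eisensteinTowerTriple (κ.unitTwist (-1)) hm S hpS hbad L hL hLS 0).cond)
                (Sum.inr v)) :
    ∀ (N : ℕ) [NeZero N] (W : WeierstrassCurve ℚ) [W.IsGloballyMinimal] (K : Type) [Field K] [NumberField K]
      (p : ℕ) [Fact p.Prime] (κ : ZpExtension K p) (γ : Field.absoluteGaloisGroup K)
      (hyp : CastellaGrossiLeeSkinner2022.Thm413Hypotheses N W K p κ γ),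
      W.HasIrreducibleModPGaloisRep p → (W.baseChange K).HasIrreducibleModPGaloisRep p →
      haveI := hyp.isElliptic
      ∀ (S : Finset (HeightOneSpectrum (𝓞 K)))
        (hpS : ∀ v, ((p : ℕ) : 𝓞 K) ∈ v.asIdeal → v ∈ S)
        (hbad : ∀ v, v ∉ S → ((p : ℕ) : 𝓞 K) ∉ v.asIdeal → (W.baseChange K).HasGoodReductionAt v),
      (∀ v ∈ S, ((p : ℕ) : 𝓞 K) ∈ v.asIdeal ∨ ((N : ℕ) : 𝓞 K) ∈ v.asIdeal) →
      (∀ (σ : K ≃ₐ[ℚ] K) (v : HeightOneSpectrum (𝓞 K)), σ • v ∈ S → v ∈ S) →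
      ∃ m₅ : ℕ, ∀ (m : ℕ) (hm : 1 ≤ m), m₅ ≤ m →
        letI := IwasawaAlgebra.isDomain_quotient_X_pow_add_C p hm
        letI := IwasawaAlgebra.isDiscreteValuationRing_quotient_X_pow_add_C p hm
        haveI := IwasawaAlgebra.EisensteinCoeff.isLocalRing_succ p hm
        letI := IwasawaAlgebra.EisensteinCoeff.algebraOfSpecSucc p m
        haveI := W.isScalarTower_algebraOfSpecSucc (K := K) (p := p) (m := m)
        letI := W.residueModuleSucc (K := K) (p := p) hm
        ∀ (π : ∀ v : HeightOneSpectrum (𝓞 K), TamePin v) (L : Set (HeightOneSpectrum (𝓞 K)))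
          (hL : L ⊆ (W.eisensteinTower (κ.unitTwist (-1)) hm).degreeTwoPrimes p) (hLS : ∀ v ∈ L, v ∉ S)
          (jbar' : AlgebraicClosure K →+* ℂ)
          (c₀ : absoluteGaloisGroup ℚ) (σ : K ≃ₐ[ℚ] K) (hσ₁ : σ ≠ 1) (hσ : σ * σ = 1)
          (hτl : IsLiftOfAut σ (absGaloisTransport (K := ℚ) (L := K) c₀).toRingEquiv)
          (hτ₂ : Function.Involutive (absGaloisTransport (K := ℚ) (L := K) c₀).toRingEquiv)
          (D : ∀ k, DualityDatum p (ConjugationDatum.ofLifts σ hσ₁ hσ _ hτl hτ₂)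
            ((W.eisensteinTower (κ.unitTwist (-1)) hm).ρ k) (IwasawaAlgebra.EisensteinCoeff p m (k + 1)))
          (e : ∀ j : ℕ, geomTorsion (W.baseChange K) ((p : ℤ) ^ j) →+ geomTorsion (W.baseChange K) ((p : ℤ) ^ j) →+
            MuCarrier K (p ^ j))
          (log : ∀ j : ℕ, MuCarrier K (p ^ j) →+ ZMod (p ^ j)),
          IsComplexConjugation (Rat.castHom ℝ) c₀ →
          (∀ x, (ConjugationDatum.ofLifts σ hσ₁ hσ _ hτl hτ₂).τ x = absGaloisTransport (K := ℚ) (L := K) c₀ x) →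
          (∀ k, (D k).e = ZpExtension.eisensteinDualityForm hm (k + 1)
            (conjPairing (e (k + 1)) ((ConjugationDatum.ofLifts σ hσ₁ hσ _ hτl hτ₂).isLift.torsionMap W _)
              (log (k + 1)))) →
          (∀ k (x y : EisensteinLevel p m (fun j ↦ geomTorsion (W.baseChange K) ((p : ℤ) ^ j)) (k + 1 + 1)),
            IwasawaAlgebra.EisensteinCoeff.reduce p m (Nat.le_succ (k + 1)) ((D (k + 1)).e x y) =
              (D k).e ((W.eisensteinTower (κ.unitTwist (-1)) hm).red k x) ((W.eisensteinTower (κ.unitTwist (-1)) hm).red k y)) →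
          (∀ j a, e j a a = 0) →
          (∀ j (g : absoluteGaloisGroup K) a b, e j (g • a) (g • b) = mu K (p ^ j) g (e j a b)) →
          (∀ j a b, e j ((ConjugationDatum.ofLifts σ hσ₁ hσ _ hτl hτ₂).isLift.torsionMap W _ a)
            ((ConjugationDatum.ofLifts σ hσ₁ hσ _ hτl hτ₂).isLift.torsionMap W _ b) = -e j a b) →
          (∀ j (a : geomTorsion (W.baseChange K) ((p : ℤ) ^ j)),
            (ConjugationDatum.ofLifts σ hσ₁ hσ _ hτl hτ₂).isLift.torsionMap W _
              ((ConjugationDatum.ofLifts σ hσ₁ hσ _ hτl hτ₂).isLift.torsionMap W _ a) = a) →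
          (∀ j, Function.Bijective (log j)) →
          (∀ j (g : absoluteGaloisGroup K) ξ, log j (mu K (p ^ j) g ξ) = cyclotomicCharacterModPow K p j g * log j ξ) →
          ∀ k, ∀ v ∈ S,
            (((W.isQuotientBy_eisensteinDVRSetting_πbar (κ.unitTwist (-1)) hm S hpS hbad L hL hLS jbar'
                (ConjugationDatum.ofLifts σ hσ₁ hσ _ hτl hτ₂) D
                (W.eisensteinLevelsTameFs (κ.unitTwist (-1)) hm π S hpS hbad L hL hLS)
                k).propagateStructure (W.eisensteinTowerTriple (κ.unitTwist (-1)) hm S hpS hbad L hL hLS k).cond)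
                (Sum.inr (σ • v))).map
                (((W.residualTauGeomTorsion (p := p) (ConjugationDatum.ofLifts σ hσ₁ hσ _ hτl hτ₂) hm (k := k + 1)
                    k.succ_pos).thetaH1 (Sum.inr v)).comp
                  ((ConjugationDatum.ofLifts σ hσ₁ hσ _ hτl hτ₂).transportH1
                    ((W.baseChange K).torsionGaloisModule (p : ℤ)) v)) =
              ((W.isQuotientBy_eisensteinDVRSetting_πbar (κ.unitTwist (-1)) hm S hpS hbad L hL hLS jbar'
                (ConjugationDatum.ofLifts σ hσ₁ hσ _ hτl hτ₂) D
                (W.eisensteinLevelsTameFs (κ.unitTwist (-1)) hm π S hpS hbad L hL hLS)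
                k).propagateStructure (W.eisensteinTowerTriple (κ.unitTwist (-1)) hm S hpS hbad L hL hLS k).cond)
                (Sum.inr v) :=
  h5bAtSERed_of_h5bAtS (h5bAtS_of_clauseZeroP H5P)

end Summit.BirchSwinnertonDyer.BirchSwinnertonDyer.Theorems.HeegnerMuPartH5bAtS

end
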